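import Summits.HodgeConjecture.HodgeConjecture.Theorems.Ring2WeilCoverageCMFieldIrrationalRows
import Summits.HodgeConjecture.HodgeConjecture.Theorems.Ring2WeilCoverageCMFieldBiquadratic
import HarnessLib

/-!
# Weil-type components over quartic CM fields with NO RATIONAL DISCRIMINANT, IV: the rows of the
# biquadratic census fields `ℚ(√-3,√5)` and `ℚ(i,√5)`

research route conditional on HC_CM; not a corollary; Q11.4-sentence-2 already refuted in dim ≥ 3.
Cell `pub-hodge-ring2`, seat `ring2-b03` (gen 57); kernel certificates for the Weil-type family-coverage census
`HOME/WEIL-FAMILY-COVERAGE.md` §b03.5 (operator priority5 2026-08-22T11:46:08Z). Companion of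
`Ring2WeilCoverageCMFieldNormParity.lean` (engine) and `Ring2WeilCoverageCMFieldIrrationalRows.lean` (certificate
`mk_ne_mk_ratCast_of_normParity`). Here: the `(field, ℓ)`-level theorems and ALL rows inside `S6` of §b03.5 with a
tabulated representative and «least rational n: –» (`|T| = 2, 4`) for `ℚ(√-3,√5)` (`R = S² + 9S + 9`,
`σ = η² = −3((1+√5)/2)²`; `ℓ = 5` — the prime `(√5)` of `F = ℚ(√5)`, RAMIFIED in `F` and INERT in `E/F`: regular
double root `σ ≡ 3 (mod 5)`, `25 ∤ R(3) = 45` — and `ℓ = 11, 29`; 21 rows) and `ℚ(i,√5)` (`R = S² + 3S + 1`,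
`σ = −((1+√5)/2)²`; `ℓ = 11, 19, 31`; 18 rows). Representatives `δ = u₀ + v₀√5` of §b03.5 are written on `{1, σ}` by
the table's own `σ` (`√5 = −(2σ+9)/3`, resp. `√5 = −(2σ+3)`); for `ℚ(√-3,√5)` the multiple `9δ ∈ ℤ[σ]` is used
(`[9δ] = [δ]`, `9 = Nm_{E/F}(3)`, `mk_mul_sq_cmNormResidueGroup`).

No named fact, no definition, no `sorry`; nothing about the Hodge conjecture is asserted.
References: [Deligne1982HodgeCycles] §4 p. 30 (1), Cor. 4.2, Lemma 4.6; [Landherr1936HermitianForms]. -/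

noncomputable section

set_option linter.dupNamespace false

open Polynomial

namespace Summit.HodgeConjecture.HodgeConjecture.Ring2.WeilCoverageCM

open Literature.AlgebraicGeometry.Deligne1982
open Literature.AlgebraicGeometry.HodgeTheory (splitDiscriminantClassCM)

/-! ### `E = ℚ(√-3,√5)`: `R = S² + 9S + 9` -/

/-- **ℚ(√-3,√5), `ℓ = 5`** (double root `σ ≡ 3, 3 (mod 5)`, non-squares: every place of `F` over `5` is
inert in `E/F`): every `δ = u + vσ ∈ ℤ[σ]` with `N_{F/ℚ}(δ) = u² - 9uv + 9v² = 5·w`, `5 ∤ w`, has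
`[δ] ≠ [c]` in `F^×/Nm_{E/F}(E^×)` for EVERY `c ∈ ℚ^×`. [cite: Deligne1982HodgeCycles, §4 p. 30 (1) and Cor. 4.2] -/
theorem sqrtNeg3Sqrt5_mk_ne_mk_ratCast_of_norm_five {R : Polynomial ℤ} (hR : R = X ^ 2 + C 9 * X + C 9)
    [Fact (Irreducible (realPolyQ R))] (u v w : ℤ) (hw : ¬ (5 : ℤ) ∣ w)
    (hN : u ^ 2 - 9 * u * v + 9 * v ^ 2 = 5 * w) (δ : (realField R)ˣ)
    (hδ : (δ : realField R) = AdjoinRoot.of (realPolyQ R) u + AdjoinRoot.of (realPolyQ R) v * AdjoinRoot.root (realPolyQ R))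
    (c : ℚ) (γ : (realField R)ˣ) (hγ : (γ : realField R) = (c : realField R)) :
    (QuotientGroup.mk δ : cmNormResidueGroup R) ≠ QuotientGroup.mk γ := by
  haveI : Fact (Irreducible (cmPolyQ R)) := fact_irreducible_cmPolyQ_of_pos hR (by norm_num) (by norm_num) disc_not_sq_nine_nine
  exact mk_ne_mk_ratCast_of_normParity hR 5 (by norm_num) 3 3 (by norm_num) (by norm_num) (by decide) (by decide)
    (by norm_num) (by norm_num) u v 0 w (by exact_mod_cast hw) (by rw [hN]; push_cast; ring) δ hδ c γ hγ

/-- **ℚ(√-3,√5), `ℓ = 11`** (two roots `σ ≡ 6, 18 (mod 11)`, non-squares: every place of `F` over `11` is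
inert in `E/F`): every `δ = u + vσ ∈ ℤ[σ]` with `N_{F/ℚ}(δ) = u² - 9uv + 9v² = 11·w`, `11 ∤ w`, has
`[δ] ≠ [c]` in `F^×/Nm_{E/F}(E^×)` for EVERY `c ∈ ℚ^×`. [cite: Deligne1982HodgeCycles, §4 p. 30 (1) and Cor. 4.2] -/
theorem sqrtNeg3Sqrt5_mk_ne_mk_ratCast_of_norm_eleven {R : Polynomial ℤ} (hR : R = X ^ 2 + C 9 * X + C 9)
    [Fact (Irreducible (realPolyQ R))] (u v w : ℤ) (hw : ¬ (11 : ℤ) ∣ w)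
    (hN : u ^ 2 - 9 * u * v + 9 * v ^ 2 = 11 * w) (δ : (realField R)ˣ)
    (hδ : (δ : realField R) = AdjoinRoot.of (realPolyQ R) u + AdjoinRoot.of (realPolyQ R) v * AdjoinRoot.root (realPolyQ R))
    (c : ℚ) (γ : (realField R)ˣ) (hγ : (γ : realField R) = (c : realField R)) :
    (QuotientGroup.mk δ : cmNormResidueGroup R) ≠ QuotientGroup.mk γ := by
  haveI : Fact (Irreducible (cmPolyQ R)) := fact_irreducible_cmPolyQ_of_pos hR (by norm_num) (by norm_num) disc_not_sq_nine_nine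
  exact mk_ne_mk_ratCast_of_normParity hR 11 (by norm_num) 6 18 (by norm_num) (by norm_num) (by decide) (by decide)
    (by norm_num) (by norm_num) u v 0 w (by exact_mod_cast hw) (by rw [hN]; push_cast; ring) δ hδ c γ hγ

/-- **ℚ(√-3,√5), `ℓ = 29`** (two roots `σ ≡ 8, 12 (mod 29)`, non-squares: every place of `F` over `29` is
inert in `E/F`): every `δ = u + vσ ∈ ℤ[σ]` with `N_{F/ℚ}(δ) = u² - 9uv + 9v² = 29·w`, `29 ∤ w`, has
`[δ] ≠ [c]` in `F^×/Nm_{E/F}(E^×)` for EVERY `c ∈ ℚ^×`. [cite: Deligne1982HodgeCycles, §4 p. 30 (1) and Cor. 4.2] -/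
theorem sqrtNeg3Sqrt5_mk_ne_mk_ratCast_of_norm_twentyNine {R : Polynomial ℤ} (hR : R = X ^ 2 + C 9 * X + C 9)
    [Fact (Irreducible (realPolyQ R))] (u v w : ℤ) (hw : ¬ (29 : ℤ) ∣ w)
    (hN : u ^ 2 - 9 * u * v + 9 * v ^ 2 = 29 * w) (δ : (realField R)ˣ)
    (hδ : (δ : realField R) = AdjoinRoot.of (realPolyQ R) u + AdjoinRoot.of (realPolyQ R) v * AdjoinRoot.root (realPolyQ R))
    (c : ℚ) (γ : (realField R)ˣ) (hγ : (γ : realField R) = (c : realField R)) :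
    (QuotientGroup.mk δ : cmNormResidueGroup R) ≠ QuotientGroup.mk γ := by
  haveI : Fact (Irreducible (cmPolyQ R)) := fact_irreducible_cmPolyQ_of_pos hR (by norm_num) (by norm_num) disc_not_sq_nine_nine
  exact mk_ne_mk_ratCast_of_normParity hR 29 (by norm_num) 8 12 (by norm_num) (by norm_num) (by decide) (by decide)
    (by norm_num) (by norm_num) u v 0 w (by exact_mod_cast hw) (by rw [hN]; push_cast; ring) δ hδ c γ hγ

/-- **ℚ(√-3,√5): rows of §b03.5 with NO RATIONAL REPRESENTATIVE, in the kernel** — for `R = X ^ 2 + C 9 * X + C 9` LITERALLY and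
each listed `(u, v)` (convention `√5 = −(2σ + 9)/3, i.e. σ = −3((1+√5)/2)² (9δ where δ ∉ ℤ[σ])`; `(u,v)` = least representative `δ` of the row `T` of §b03.5 on `{1, σ}`
— times the square shown, if `δ ∉ ℤ[σ]` —, with its norm `N_{F/ℚ}`:
  `(9,-3)` = 9·(5/2+1/2√5) {1,2}, N 405;
  `(81,3)` = 9·(15/2−1/2√5) {1,3}, N 4455;
  `(54,-3)` = 9·(15/2+1/2√5) {1,4}, N 4455;
  `(8,-1)` = 25/2+3/2√5 {1,5}, N 145;
  `(17,1)` = 25/2−3/2√5 {1,6}, N 145;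
  `(18,-3)` = 9·(7/2+1/2√5) {2,3}, N 891;
  `(45,3)` = 9·(7/2−1/2√5) {2,4}, N 891;
  `(63,3)` = 9·(11/2−1/2√5) {2,5}, N 2349;
  `(36,-3)` = 9·(11/2+1/2√5) {2,6}, N 2349;
  `(135,-6)` = 9·(18+√5) {3,5}, N 25839;
  `(270,21)` = 9·(39/2−7/2√5) {3,6}, N 25839;
  `(81,-21)` = 9·(39/2+7/2√5) {4,5}, N 25839;
  `(189,6)` = 9·(18−√5) {4,6}, N 25839;
  `(99,-33)` = 9·(55/2+11/2√5) {1,2,3,4}, N 49005;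
  `(558,39)` = 9·(85/2−13/2√5) {1,2,3,5}, N 129195;
  `(333,-6)` = 9·(40+√5) {1,2,3,6}, N 129195;
  `(387,6)` = 9·(40−√5) {1,2,4,5}, N 129195;
  `(207,-39)` = 9·(85/2+13/2√5) {1,2,4,6}, N 129195;
  `(1044,87)` = 9·(145/2−29/2√5) {1,2,5,6}, N 340605;
  `(693,33)` = 9·(121/2−11/2√5) {2,3,4,5}, N 284229;
  `(1287,132)` = 9·(77−22√5) {2,3,4,6}, N 284229):
the class `[u + vσ]` differs from `[c]` for EVERY `c ∈ ℚ^×` — the component `W8.E.[u + vσ]` is none of the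
integer-indexed rows `[n]` and not the split row. [cite: Deligne1982HodgeCycles, §4 p. 30 (1) and Cor. 4.2] -/
theorem sqrtNeg3Sqrt5_irrational_rows :
    haveI := fact_irreducible_realPolyQ_of_not_sq (R := X ^ 2 + C 9 * X + C 9) rfl disc_not_sq_nine_nine
    ∀ uv ∈ [((9 : ℤ), (-3 : ℤ)), (81, 3), (54, -3), (8, -1), (17, 1), (18, -3), (45, 3), (63, 3), (36, -3), (135, -6), (270, 21), (81, -21), (189, 6), (99, -33), (558, 39), (333, -6), (387, 6), (207, -39), (1044, 87), (693, 33), (1287, 132)],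
      ∀ δ : (realField (X ^ 2 + C 9 * X + C 9))ˣ,
        (δ : realField (X ^ 2 + C 9 * X + C 9)) = AdjoinRoot.of (realPolyQ (X ^ 2 + C 9 * X + C 9)) (uv.1 : ℚ)
            + AdjoinRoot.of (realPolyQ (X ^ 2 + C 9 * X + C 9)) (uv.2 : ℚ) * AdjoinRoot.root (realPolyQ (X ^ 2 + C 9 * X + C 9)) →
        ∀ (c : ℚ) (γ : (realField (X ^ 2 + C 9 * X + C 9))ˣ), (γ : realField (X ^ 2 + C 9 * X + C 9)) = (c : realField (X ^ 2 + C 9 * X + C 9)) →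
          (QuotientGroup.mk δ : cmNormResidueGroup (X ^ 2 + C 9 * X + C 9)) ≠ QuotientGroup.mk γ := by
  haveI := fact_irreducible_realPolyQ_of_not_sq (R := X ^ 2 + C 9 * X + C 9) rfl disc_not_sq_nine_nine
  intro uv huv δ hδ c γ hγ
  obtain ⟨u, v⟩ := uv
  simp only [List.mem_cons, Prod.mk.injEq, List.not_mem_nil, or_false] at huv
  rcases huv with ⟨rfl, rfl⟩ | ⟨rfl, rfl⟩ | ⟨rfl, rfl⟩ | ⟨rfl, rfl⟩ | ⟨rfl, rfl⟩ | ⟨rfl, rfl⟩ | ⟨rfl, rfl⟩ | ⟨rfl, rfl⟩ | ⟨rfl, rfl⟩ | ⟨rfl, rfl⟩ | ⟨rfl, rfl⟩ | ⟨rfl, rfl⟩ | ⟨rfl, rfl⟩ | ⟨rfl, rfl⟩ | ⟨rfl, rfl⟩ | ⟨rfl, rfl⟩ | ⟨rfl, rfl⟩ | ⟨rfl, rfl⟩ | ⟨rfl, rfl⟩ | ⟨rfl, rfl⟩ | ⟨rfl, rfl⟩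
  · exact sqrtNeg3Sqrt5_mk_ne_mk_ratCast_of_norm_five rfl 9 (-3) (81) (by norm_num) (by norm_num) δ hδ c γ hγ
  · exact sqrtNeg3Sqrt5_mk_ne_mk_ratCast_of_norm_five rfl 81 (3) (891) (by norm_num) (by norm_num) δ hδ c γ hγ
  · exact sqrtNeg3Sqrt5_mk_ne_mk_ratCast_of_norm_five rfl 54 (-3) (891) (by norm_num) (by norm_num) δ hδ c γ hγ
  · exact sqrtNeg3Sqrt5_mk_ne_mk_ratCast_of_norm_five rfl 8 (-1) (29) (by norm_num) (by norm_num) δ hδ c γ hγ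
  · exact sqrtNeg3Sqrt5_mk_ne_mk_ratCast_of_norm_five rfl 17 (1) (29) (by norm_num) (by norm_num) δ hδ c γ hγ
  · exact sqrtNeg3Sqrt5_mk_ne_mk_ratCast_of_norm_eleven rfl 18 (-3) (81) (by norm_num) (by norm_num) δ hδ c γ hγ
  · exact sqrtNeg3Sqrt5_mk_ne_mk_ratCast_of_norm_eleven rfl 45 (3) (81) (by norm_num) (by norm_num) δ hδ c γ hγ
  · exact sqrtNeg3Sqrt5_mk_ne_mk_ratCast_of_norm_twentyNine rfl 63 (3) (81) (by norm_num) (by norm_num) δ hδ c γ hγ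
  · exact sqrtNeg3Sqrt5_mk_ne_mk_ratCast_of_norm_twentyNine rfl 36 (-3) (81) (by norm_num) (by norm_num) δ hδ c γ hγ
  · exact sqrtNeg3Sqrt5_mk_ne_mk_ratCast_of_norm_eleven rfl 135 (-6) (2349) (by norm_num) (by norm_num) δ hδ c γ hγ
  · exact sqrtNeg3Sqrt5_mk_ne_mk_ratCast_of_norm_eleven rfl 270 (21) (2349) (by norm_num) (by norm_num) δ hδ c γ hγ
  · exact sqrtNeg3Sqrt5_mk_ne_mk_ratCast_of_norm_eleven rfl 81 (-21) (2349) (by norm_num) (by norm_num) δ hδ c γ hγ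
  · exact sqrtNeg3Sqrt5_mk_ne_mk_ratCast_of_norm_eleven rfl 189 (6) (2349) (by norm_num) (by norm_num) δ hδ c γ hγ
  · exact sqrtNeg3Sqrt5_mk_ne_mk_ratCast_of_norm_five rfl 99 (-33) (9801) (by norm_num) (by norm_num) δ hδ c γ hγ
  · exact sqrtNeg3Sqrt5_mk_ne_mk_ratCast_of_norm_five rfl 558 (39) (25839) (by norm_num) (by norm_num) δ hδ c γ hγ
  · exact sqrtNeg3Sqrt5_mk_ne_mk_ratCast_of_norm_five rfl 333 (-6) (25839) (by norm_num) (by norm_num) δ hδ c γ hγ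
  · exact sqrtNeg3Sqrt5_mk_ne_mk_ratCast_of_norm_five rfl 387 (6) (25839) (by norm_num) (by norm_num) δ hδ c γ hγ
  · exact sqrtNeg3Sqrt5_mk_ne_mk_ratCast_of_norm_five rfl 207 (-39) (25839) (by norm_num) (by norm_num) δ hδ c γ hγ
  · exact sqrtNeg3Sqrt5_mk_ne_mk_ratCast_of_norm_five rfl 1044 (87) (68121) (by norm_num) (by norm_num) δ hδ c γ hγ
  · exact sqrtNeg3Sqrt5_mk_ne_mk_ratCast_of_norm_twentyNine rfl 693 (33) (9801) (by norm_num) (by norm_num) δ hδ c γ hγ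
  · exact sqrtNeg3Sqrt5_mk_ne_mk_ratCast_of_norm_twentyNine rfl 1287 (132) (9801) (by norm_num) (by norm_num) δ hδ c γ hγ

/-! ### `E = ℚ(i,√5)`: `R = S² + 3S + 1` -/

/-- **ℚ(i,√5), `ℓ = 11`** (two roots `σ ≡ 2, 6 (mod 11)`, non-squares: every place of `F` over `11` is
inert in `E/F`): every `δ = u + vσ ∈ ℤ[σ]` with `N_{F/ℚ}(δ) = u² - 3uv + 1v² = 11·w`, `11 ∤ w`, has
`[δ] ≠ [c]` in `F^×/Nm_{E/F}(E^×)` for EVERY `c ∈ ℚ^×`. [cite: Deligne1982HodgeCycles, §4 p. 30 (1) and Cor. 4.2] -/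
theorem sqrtNeg1Sqrt5_mk_ne_mk_ratCast_of_norm_eleven {R : Polynomial ℤ} (hR : R = X ^ 2 + C 3 * X + C 1)
    [Fact (Irreducible (realPolyQ R))] (u v w : ℤ) (hw : ¬ (11 : ℤ) ∣ w)
    (hN : u ^ 2 - 3 * u * v + 1 * v ^ 2 = 11 * w) (δ : (realField R)ˣ)
    (hδ : (δ : realField R) = AdjoinRoot.of (realPolyQ R) u + AdjoinRoot.of (realPolyQ R) v * AdjoinRoot.root (realPolyQ R))
    (c : ℚ) (γ : (realField R)ˣ) (hγ : (γ : realField R) = (c : realField R)) :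
    (QuotientGroup.mk δ : cmNormResidueGroup R) ≠ QuotientGroup.mk γ := by
  haveI : Fact (Irreducible (cmPolyQ R)) := fact_irreducible_cmPolyQ_of_pos hR (by norm_num) (by norm_num) disc_not_sq_three_one
  exact mk_ne_mk_ratCast_of_normParity hR 11 (by norm_num) 2 6 (by norm_num) (by norm_num) (by decide) (by decide)
    (by norm_num) (by norm_num) u v 0 w (by exact_mod_cast hw) (by rw [hN]; push_cast; ring) δ hδ c γ hγ

/-- **ℚ(i,√5), `ℓ = 19`** (two roots `σ ≡ 3, 13 (mod 19)`, non-squares: every place of `F` over `19` is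
inert in `E/F`): every `δ = u + vσ ∈ ℤ[σ]` with `N_{F/ℚ}(δ) = u² - 3uv + 1v² = 19·w`, `19 ∤ w`, has
`[δ] ≠ [c]` in `F^×/Nm_{E/F}(E^×)` for EVERY `c ∈ ℚ^×`. [cite: Deligne1982HodgeCycles, §4 p. 30 (1) and Cor. 4.2] -/
theorem sqrtNeg1Sqrt5_mk_ne_mk_ratCast_of_norm_nineteen {R : Polynomial ℤ} (hR : R = X ^ 2 + C 3 * X + C 1)
    [Fact (Irreducible (realPolyQ R))] (u v w : ℤ) (hw : ¬ (19 : ℤ) ∣ w)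
    (hN : u ^ 2 - 3 * u * v + 1 * v ^ 2 = 19 * w) (δ : (realField R)ˣ)
    (hδ : (δ : realField R) = AdjoinRoot.of (realPolyQ R) u + AdjoinRoot.of (realPolyQ R) v * AdjoinRoot.root (realPolyQ R))
    (c : ℚ) (γ : (realField R)ˣ) (hγ : (γ : realField R) = (c : realField R)) :
    (QuotientGroup.mk δ : cmNormResidueGroup R) ≠ QuotientGroup.mk γ := by
  haveI : Fact (Irreducible (cmPolyQ R)) := fact_irreducible_cmPolyQ_of_pos hR (by norm_num) (by norm_num) disc_not_sq_three_one
  exact mk_ne_mk_ratCast_of_normParity hR 19 (by norm_num) 3 13 (by norm_num) (by norm_num) (by decide) (by decide)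
    (by norm_num) (by norm_num) u v 0 w (by exact_mod_cast hw) (by rw [hN]; push_cast; ring) δ hδ c γ hγ

/-- **ℚ(i,√5), `ℓ = 31`** (two roots `σ ≡ 11, 17 (mod 31)`, non-squares: every place of `F` over `31` is
inert in `E/F`): every `δ = u + vσ ∈ ℤ[σ]` with `N_{F/ℚ}(δ) = u² - 3uv + 1v² = 31·w`, `31 ∤ w`, has
`[δ] ≠ [c]` in `F^×/Nm_{E/F}(E^×)` for EVERY `c ∈ ℚ^×`. [cite: Deligne1982HodgeCycles, §4 p. 30 (1) and Cor. 4.2] -/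
theorem sqrtNeg1Sqrt5_mk_ne_mk_ratCast_of_norm_thirtyOne {R : Polynomial ℤ} (hR : R = X ^ 2 + C 3 * X + C 1)
    [Fact (Irreducible (realPolyQ R))] (u v w : ℤ) (hw : ¬ (31 : ℤ) ∣ w)
    (hN : u ^ 2 - 3 * u * v + 1 * v ^ 2 = 31 * w) (δ : (realField R)ˣ)
    (hδ : (δ : realField R) = AdjoinRoot.of (realPolyQ R) u + AdjoinRoot.of (realPolyQ R) v * AdjoinRoot.root (realPolyQ R))
    (c : ℚ) (γ : (realField R)ˣ) (hγ : (γ : realField R) = (c : realField R)) :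
    (QuotientGroup.mk δ : cmNormResidueGroup R) ≠ QuotientGroup.mk γ := by
  haveI : Fact (Irreducible (cmPolyQ R)) := fact_irreducible_cmPolyQ_of_pos hR (by norm_num) (by norm_num) disc_not_sq_three_one
  exact mk_ne_mk_ratCast_of_normParity hR 31 (by norm_num) 11 17 (by norm_num) (by norm_num) (by decide) (by decide)
    (by norm_num) (by norm_num) u v 0 w (by exact_mod_cast hw) (by rw [hN]; push_cast; ring) δ hδ c γ hγ

/-- **ℚ(i,√5): rows of §b03.5 with NO RATIONAL REPRESENTATIVE, in the kernel** — for `R = X ^ 2 + C 3 * X + C 1` LITERALLY and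
each listed `(u, v)` (convention `√5 = −(2σ + 3), i.e. σ = −((1+√5)/2)²`; `(u,v)` = least representative `δ` of the row `T` of §b03.5 on `{1, σ}`
— times the square shown, if `δ ∉ ℤ[σ]` —, with its norm `N_{F/ℚ}`:
  `(2,-1)` = 7/2+1/2√5 {1,2}, N 11;
  `(5,1)` = 7/2−1/2√5 {1,3}, N 11;
  `(3,-1)` = 9/2+1/2√5 {1,4}, N 19;
  `(6,1)` = 9/2−1/2√5 {1,5}, N 19;
  `(9,2)` = 6−√5 {1,6}, N 31;
  `(23,5)` = 31/2−5/2√5 {2,4}, N 209;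
  `(13,-1)` = 29/2+1/2√5 {2,5}, N 209;
  `(20,1)` = 37/2−1/2√5 {2,6}, N 341;
  `(16,1)` = 29/2−1/2√5 {3,4}, N 209;
  `(8,-5)` = 31/2+5/2√5 {3,5}, N 209;
  `(13,-4)` = 19+2√5 {3,6}, N 341;
  `(29,3)` = 49/2−3/2√5 {4,6}, N 589;
  `(15,-7)` = 51/2+7/2√5 {5,6}, N 589;
  `(33,-11)` = 99/2+11/2√5 {1,2,3,4}, N 2299;
  `(66,11)` = 99/2−11/2√5 {1,2,3,5}, N 2299;
  `(99,22)` = 66−11√5 {1,2,3,6}, N 3751;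
  `(133,38)` = 76−19√5 {1,2,4,5}, N 3971;
  `(95,19)` = 133/2−19/2√5 {1,3,4,5}, N 3971):
the class `[u + vσ]` differs from `[c]` for EVERY `c ∈ ℚ^×` — the component `W8.E.[u + vσ]` is none of the
integer-indexed rows `[n]` and not the split row. [cite: Deligne1982HodgeCycles, §4 p. 30 (1) and Cor. 4.2] -/
theorem sqrtNeg1Sqrt5_irrational_rows :
    haveI := fact_irreducible_realPolyQ_of_not_sq (R := X ^ 2 + C 3 * X + C 1) rfl disc_not_sq_three_one
    ∀ uv ∈ [((2 : ℤ), (-1 : ℤ)), (5, 1), (3, -1), (6, 1), (9, 2), (23, 5), (13, -1), (20, 1), (16, 1), (8, -5), (13, -4), (29, 3), (15, -7), (33, -11), (66, 11), (99, 22), (133, 38), (95, 19)],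
      ∀ δ : (realField (X ^ 2 + C 3 * X + C 1))ˣ,
        (δ : realField (X ^ 2 + C 3 * X + C 1)) = AdjoinRoot.of (realPolyQ (X ^ 2 + C 3 * X + C 1)) (uv.1 : ℚ)
            + AdjoinRoot.of (realPolyQ (X ^ 2 + C 3 * X + C 1)) (uv.2 : ℚ) * AdjoinRoot.root (realPolyQ (X ^ 2 + C 3 * X + C 1)) →
        ∀ (c : ℚ) (γ : (realField (X ^ 2 + C 3 * X + C 1))ˣ), (γ : realField (X ^ 2 + C 3 * X + C 1)) = (c : realField (X ^ 2 + C 3 * X + C 1)) →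
          (QuotientGroup.mk δ : cmNormResidueGroup (X ^ 2 + C 3 * X + C 1)) ≠ QuotientGroup.mk γ := by
  haveI := fact_irreducible_realPolyQ_of_not_sq (R := X ^ 2 + C 3 * X + C 1) rfl disc_not_sq_three_one
  intro uv huv δ hδ c γ hγ
  obtain ⟨u, v⟩ := uv
  simp only [List.mem_cons, Prod.mk.injEq, List.not_mem_nil, or_false] at huv
  rcases huv with ⟨rfl, rfl⟩ | ⟨rfl, rfl⟩ | ⟨rfl, rfl⟩ | ⟨rfl, rfl⟩ | ⟨rfl, rfl⟩ | ⟨rfl, rfl⟩ | ⟨rfl, rfl⟩ | ⟨rfl, rfl⟩ | ⟨rfl, rfl⟩ | ⟨rfl, rfl⟩ | ⟨rfl, rfl⟩ | ⟨rfl, rfl⟩ | ⟨rfl, rfl⟩ | ⟨rfl, rfl⟩ | ⟨rfl, rfl⟩ | ⟨rfl, rfl⟩ | ⟨rfl, rfl⟩ | ⟨rfl, rfl⟩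
  · exact sqrtNeg1Sqrt5_mk_ne_mk_ratCast_of_norm_eleven rfl 2 (-1) (1) (by norm_num) (by norm_num) δ hδ c γ hγ
  · exact sqrtNeg1Sqrt5_mk_ne_mk_ratCast_of_norm_eleven rfl 5 (1) (1) (by norm_num) (by norm_num) δ hδ c γ hγ
  · exact sqrtNeg1Sqrt5_mk_ne_mk_ratCast_of_norm_nineteen rfl 3 (-1) (1) (by norm_num) (by norm_num) δ hδ c γ hγ
  · exact sqrtNeg1Sqrt5_mk_ne_mk_ratCast_of_norm_nineteen rfl 6 (1) (1) (by norm_num) (by norm_num) δ hδ c γ hγ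
  · exact sqrtNeg1Sqrt5_mk_ne_mk_ratCast_of_norm_thirtyOne rfl 9 (2) (1) (by norm_num) (by norm_num) δ hδ c γ hγ
  · exact sqrtNeg1Sqrt5_mk_ne_mk_ratCast_of_norm_eleven rfl 23 (5) (19) (by norm_num) (by norm_num) δ hδ c γ hγ
  · exact sqrtNeg1Sqrt5_mk_ne_mk_ratCast_of_norm_eleven rfl 13 (-1) (19) (by norm_num) (by norm_num) δ hδ c γ hγ
  · exact sqrtNeg1Sqrt5_mk_ne_mk_ratCast_of_norm_eleven rfl 20 (1) (31) (by norm_num) (by norm_num) δ hδ c γ hγ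
  · exact sqrtNeg1Sqrt5_mk_ne_mk_ratCast_of_norm_eleven rfl 16 (1) (19) (by norm_num) (by norm_num) δ hδ c γ hγ
  · exact sqrtNeg1Sqrt5_mk_ne_mk_ratCast_of_norm_eleven rfl 8 (-5) (19) (by norm_num) (by norm_num) δ hδ c γ hγ
  · exact sqrtNeg1Sqrt5_mk_ne_mk_ratCast_of_norm_eleven rfl 13 (-4) (31) (by norm_num) (by norm_num) δ hδ c γ hγ
  · exact sqrtNeg1Sqrt5_mk_ne_mk_ratCast_of_norm_nineteen rfl 29 (3) (31) (by norm_num) (by norm_num) δ hδ c γ hγ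
  · exact sqrtNeg1Sqrt5_mk_ne_mk_ratCast_of_norm_nineteen rfl 15 (-7) (31) (by norm_num) (by norm_num) δ hδ c γ hγ
  · exact sqrtNeg1Sqrt5_mk_ne_mk_ratCast_of_norm_nineteen rfl 33 (-11) (121) (by norm_num) (by norm_num) δ hδ c γ hγ
  · exact sqrtNeg1Sqrt5_mk_ne_mk_ratCast_of_norm_nineteen rfl 66 (11) (121) (by norm_num) (by norm_num) δ hδ c γ hγ
  · exact sqrtNeg1Sqrt5_mk_ne_mk_ratCast_of_norm_thirtyOne rfl 99 (22) (121) (by norm_num) (by norm_num) δ hδ c γ hγ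
  · exact sqrtNeg1Sqrt5_mk_ne_mk_ratCast_of_norm_eleven rfl 133 (38) (361) (by norm_num) (by norm_num) δ hδ c γ hγ
  · exact sqrtNeg1Sqrt5_mk_ne_mk_ratCast_of_norm_eleven rfl 95 (19) (361) (by norm_num) (by norm_num) δ hδ c γ hγ

end Summit.HodgeConjecture.HodgeConjecture.Ring2.WeilCoverageCM

end
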